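import Summits.Ventures.HodgeRepro2.T5InertSelfDualNormalForm

/-!
# Uniqueness of the self-dual lattice at an inert place: any two are conjugate under `U(H)`
(cell pub-hodge-repro2, seat p3)

Tier-5 N3 support (LEAN-ANNEX-p8.md §108 / T5-147: «what stays prose: … the record's choice of a self-dual
`L_v`»). File 181 (`T5InertSelfDualNormalForm.exists_congruent_J3_one_adicCompletion`) puts every unimodular
hermitian Gram matrix of rank `3` at an inert place into the form `Pᴴ H P = antidiag(1, 1, 1)` with
`P ∈ GL₃(𝒪_{E_v})`. Consequently the record's choice of the self-dual lattice `L_v` is immaterial: in the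
vocabulary of seat p8's T5-128 / T5-147 (a lattice `Q · 𝒪_{E_v}³`, `Q ∈ GL₃(L_w)`, is self-dual for `H` when
`dualLattice 𝒪_{E_v} (Qᴴ H Q) (stdLattice 𝒪_{E_v}) = stdLattice 𝒪_{E_v}`),
* `exists_congruent_J3_one_of_dualLattice_eq` — a unimodular Gram matrix `G` (`𝒪³` self-dual for `G`) is
  integrally congruent to `antidiag(1, 1, 1)`;
* **`exists_isometry_mul_eq_of_dualLattice_eq`** — for two self-dual lattices `Q₁ 𝒪³`, `Q₂ 𝒪³` of `(L_w³, H)`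
  there is an isometry `g` (`gᴴ H g = H`) with `g Q₂ = Q₁ M`, `M ∈ GL₃(𝒪_{E_v})`;
* **`exists_isometry_image_stdLattice_eq`** — the same as an equality of lattices: `g · (Q₂ 𝒪³) = Q₁ 𝒪³`.
Hence the stabilisers of any two self-dual lattices (p8's hyperspecial subgroups) are conjugate in `U(H)`.

Mathlib + this seat's file 181 and its imports (seat p8's T5-128 / T5-143 / T5-147 / T5-155); no display; no
device. §8(d): uses an L-value-free non-vanishing device: NO.
-/

namespace Summit.Ventures.HodgeRepro2.T5InertSelfDualUnique

open Matrix IsDedekindDomain IsDedekindDomain.HeightOneSpectrum NumberField Module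
open Summit.Ventures.HodgeRepro2.T5IntegralUnits Summit.Ventures.HodgeRepro2.T5HermitianThreeElements
  Summit.Ventures.HodgeRepro2.T5UnitaryGroupIsometry Summit.Ventures.HodgeRepro2.T5StarOfInvolution
  Summit.Ventures.HodgeRepro2.T5InertHeckeCommutative Summit.Ventures.HodgeRepro2.T5UnitaryThreeCorner
  Summit.Ventures.HodgeRepro2.T5InertSelfDualNormalForm

section Local

variable {K : Type*} [Field K] [NumberField K] (v : HeightOneSpectrum (𝓞 K))
variable {L : Type*} [Field L] [NumberField L] [Algebra K L]
variable (w : HeightOneSpectrum (𝓞 L)) [w.asIdeal.LiesOver v.asIdeal]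

/-- **A unimodular Gram matrix is integrally congruent to `antidiag(1, 1, 1)`.** Under the hypotheses of file 181
(`[L_w : K_v] = 2`, a uniformiser `ϖ` of `O_Kv` irreducible in `O_Lw`, the conjugation `σ ≠ 1`, the star
`starRingOfQuadratic h2 σ hσ`): if `G` is hermitian with `IsUnit G.det` and the standard lattice `𝒪³` is
self-dual for `G` (`dualLattice 𝒪 G (stdLattice 𝒪) = stdLattice 𝒪`), then `Pᴴ G P = antidiag(1, 1, 1)` for some
`P` with entries in `𝒪_{E_v}` and an `𝒪_{E_v}`-unit determinant — p8's T5-128 `integral_of_dualLattice_stdLattice_eq`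
(entries and inverse of `G` integral) and file 181. -/
theorem exists_congruent_J3_one_of_dualLattice_eq
    (h2 : finrank (v.adicCompletion K) (w.adicCompletion L) = 2)
    {ϖ : v.adicCompletionIntegers K} (hϖ : Irreducible ϖ)
    (hinert : Irreducible (algebraMap (v.adicCompletionIntegers K) (w.adicCompletionIntegers L) ϖ))
    (σ : w.adicCompletion L ≃ₐ[v.adicCompletion K] w.adicCompletion L) (hσ : σ ≠ 1)
    {G : Matrix (Fin 3) (Fin 3) (w.adicCompletion L)}
    (hG : letI := starRingOfQuadratic h2 σ hσ; G.IsHermitian) (hGdet : IsUnit G.det)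
    (hself : letI := starRingOfQuadratic h2 σ hσ
      dualLattice (integralClosure (v.adicCompletionIntegers K) (w.adicCompletion L)) G
        (stdLattice (integralClosure (v.adicCompletionIntegers K) (w.adicCompletion L))) =
      stdLattice (integralClosure (v.adicCompletionIntegers K) (w.adicCompletion L))) :
    letI := starRingOfQuadratic h2 σ hσ
    ∃ P : Matrix (Fin 3) (Fin 3) (w.adicCompletion L),
      (∀ i j, IsLocalization.IsInteger
        (integralClosure (v.adicCompletionIntegers K) (w.adicCompletion L)) (P i j)) ∧
      IsRUnit (integralClosure (v.adicCompletionIntegers K) (w.adicCompletion L)) P.det ∧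
      P.conjTranspose * G * P = J3 1 := by
  letI := starRingOfQuadratic h2 σ hσ
  -- the star is `σ`, and it preserves `𝒪_{E_v}`
  have hstar : ∀ y : w.adicCompletion L, star y = σ y := fun y => star_eq σ.toRingEquiv _ y
  have hstarInt : ∀ x : w.adicCompletion L,
      IsLocalization.IsInteger (integralClosure (v.adicCompletionIntegers K) (w.adicCompletion L)) x →
      IsLocalization.IsInteger (integralClosure (v.adicCompletionIntegers K) (w.adicCompletion L)) (star x) :=
    fun x hx => by
      rw [hstar]
      exact (isInteger_integralClosure_iff _).2
        (map_mem_integralClosure σ ((isInteger_integralClosure_iff _).1 hx))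
  obtain ⟨hint, hinv⟩ :=
    integral_of_dualLattice_stdLattice_eq hstarInt (Matrix.nonsing_inv_mul G hGdet) hself
  exact exists_congruent_J3_one_adicCompletion v w h2 hϖ hinert σ hσ hG hint hGdet hinv

/-- **Any two self-dual lattices of `(L_w³, H)` at an inert place are conjugate under `U(H)`** (matrix form).
Under the hypotheses of file 181 (`[L_w : K_v] = 2`, a uniformiser `ϖ` of `O_Kv` irreducible in `O_Lw`, the
conjugation `σ ≠ 1`, `H` hermitian for `starRingOfQuadratic h2 σ hσ` with `IsUnit H.det`): if `Q₁ 𝒪³` and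
`Q₂ 𝒪³` are self-dual (`Qᵢ ∈ GL₃(L_w)`, `dualLattice 𝒪 (Qᵢᴴ H Qᵢ) (stdLattice 𝒪) = stdLattice 𝒪`), there is
`g` with `gᴴ H g = H` and `g Q₂ = Q₁ M` for some `M` with entries in `𝒪_{E_v}` and an `𝒪_{E_v}`-unit
determinant. Proof: both Gram matrices `Qᵢᴴ H Qᵢ` are unimodular, hence `Pᵢᴴ (Qᵢᴴ H Qᵢ) Pᵢ = antidiag(1,1,1)`
with `Pᵢ ∈ GL₃(𝒪)` (`exists_congruent_J3_one_of_dualLattice_eq`); `g := (Q₁ P₁) (Q₂ P₂)⁻¹`, `M := P₁ P₂⁻¹`. -/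
theorem exists_isometry_mul_eq_of_dualLattice_eq
    (h2 : finrank (v.adicCompletion K) (w.adicCompletion L) = 2)
    {ϖ : v.adicCompletionIntegers K} (hϖ : Irreducible ϖ)
    (hinert : Irreducible (algebraMap (v.adicCompletionIntegers K) (w.adicCompletionIntegers L) ϖ))
    (σ : w.adicCompletion L ≃ₐ[v.adicCompletion K] w.adicCompletion L) (hσ : σ ≠ 1)
    {H : Matrix (Fin 3) (Fin 3) (w.adicCompletion L)}
    (hH : letI := starRingOfQuadratic h2 σ hσ; H.IsHermitian) (hdet : IsUnit H.det)
    {Q₁ Q₂ : Matrix (Fin 3) (Fin 3) (w.adicCompletion L)} (hQ₁ : IsUnit Q₁) (hQ₂ : IsUnit Q₂)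
    (h₁ : letI := starRingOfQuadratic h2 σ hσ
      dualLattice (integralClosure (v.adicCompletionIntegers K) (w.adicCompletion L))
        (Q₁.conjTranspose * H * Q₁)
        (stdLattice (integralClosure (v.adicCompletionIntegers K) (w.adicCompletion L))) =
      stdLattice (integralClosure (v.adicCompletionIntegers K) (w.adicCompletion L)))
    (h₂ : letI := starRingOfQuadratic h2 σ hσ
      dualLattice (integralClosure (v.adicCompletionIntegers K) (w.adicCompletion L))
        (Q₂.conjTranspose * H * Q₂)
        (stdLattice (integralClosure (v.adicCompletionIntegers K) (w.adicCompletion L))) =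
      stdLattice (integralClosure (v.adicCompletionIntegers K) (w.adicCompletion L))) :
    letI := starRingOfQuadratic h2 σ hσ
    ∃ g : Matrix (Fin 3) (Fin 3) (w.adicCompletion L), g.conjTranspose * H * g = H ∧
      ∃ M : Matrix (Fin 3) (Fin 3) (w.adicCompletion L),
        (∀ i j, IsLocalization.IsInteger
          (integralClosure (v.adicCompletionIntegers K) (w.adicCompletion L)) (M i j)) ∧
        IsRUnit (integralClosure (v.adicCompletionIntegers K) (w.adicCompletion L)) M.det ∧
        g * Q₂ = Q₁ * M := by
  letI := starRingOfQuadratic h2 σ hσ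
  have hQ₁det : IsUnit Q₁.det := (Matrix.isUnit_iff_isUnit_det Q₁).1 hQ₁
  have hQ₂det : IsUnit Q₂.det := (Matrix.isUnit_iff_isUnit_det Q₂).1 hQ₂
  -- the two Gram matrices are unimodular hermitian
  set G₁ : Matrix (Fin 3) (Fin 3) (w.adicCompletion L) := Q₁.conjTranspose * H * Q₁ with hG₁
  set G₂ : Matrix (Fin 3) (Fin 3) (w.adicCompletion L) := Q₂.conjTranspose * H * Q₂ with hG₂
  have hG₁h : G₁.IsHermitian := Matrix.isHermitian_conjTranspose_mul_mul Q₁ hH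
  have hG₂h : G₂.IsHermitian := Matrix.isHermitian_conjTranspose_mul_mul Q₂ hH
  have hdet₁ : IsUnit G₁.det := by
    rw [hG₁, Matrix.det_mul, Matrix.det_mul, Matrix.det_conjTranspose]
    exact ((isUnit_star.mpr hQ₁det).mul hdet).mul hQ₁det
  have hdet₂ : IsUnit G₂.det := by
    rw [hG₂, Matrix.det_mul, Matrix.det_mul, Matrix.det_conjTranspose]
    exact ((isUnit_star.mpr hQ₂det).mul hdet).mul hQ₂det
  obtain ⟨P₁, hP₁, hP₁det, hPHP₁⟩ :=
    exists_congruent_J3_one_of_dualLattice_eq v w h2 hϖ hinert σ hσ hG₁h hdet₁ h₁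
  obtain ⟨P₂, hP₂, hP₂det, hPHP₂⟩ :=
    exists_congruent_J3_one_of_dualLattice_eq v w h2 hϖ hinert σ hσ hG₂h hdet₂ h₂
  -- `A := Q₁ P₁`, `B := Q₂ P₂` both carry `H` to `antidiag(1, 1, 1)`
  have hA : (Q₁ * P₁).conjTranspose * H * (Q₁ * P₁) = J3 1 := by
    rw [← hPHP₁, hG₁]; simp only [Matrix.conjTranspose_mul, Matrix.mul_assoc]
  have hB : (Q₂ * P₂).conjTranspose * H * (Q₂ * P₂) = J3 1 := by
    rw [← hPHP₂, hG₂]; simp only [Matrix.conjTranspose_mul, Matrix.mul_assoc]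
  have hP₂det' : IsUnit P₂.det := isUnit_iff_exists_inv.2 ⟨P₂.det⁻¹, mul_inv_cancel₀ hP₂det.2.1⟩
  have hBdet : IsUnit (Q₂ * P₂).det := by
    rw [Matrix.det_mul]; exact hQ₂det.mul hP₂det'
  refine ⟨Q₁ * P₁ * (Q₂ * P₂)⁻¹, ?_, P₁ * P₂⁻¹, isInteger_mul_apply hP₁
    (isInteger_inv_apply_of_isRUnit_det hP₂ hP₂det), ?_, ?_⟩
  · calc (Q₁ * P₁ * (Q₂ * P₂)⁻¹).conjTranspose * H * (Q₁ * P₁ * (Q₂ * P₂)⁻¹)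
        = ((Q₂ * P₂)⁻¹).conjTranspose * ((Q₁ * P₁).conjTranspose * H * (Q₁ * P₁)) * (Q₂ * P₂)⁻¹ := by
          simp only [Matrix.conjTranspose_mul, Matrix.mul_assoc]
      _ = ((Q₂ * P₂)⁻¹).conjTranspose * ((Q₂ * P₂).conjTranspose * H * (Q₂ * P₂)) * (Q₂ * P₂)⁻¹ := by
          rw [hA, hB]
      _ = ((Q₂ * P₂) * (Q₂ * P₂)⁻¹).conjTranspose * H * ((Q₂ * P₂) * (Q₂ * P₂)⁻¹) := by
          simp only [Matrix.conjTranspose_mul, Matrix.mul_assoc]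
      _ = H := by
          rw [Matrix.mul_nonsing_inv _ hBdet, Matrix.conjTranspose_one, Matrix.one_mul, Matrix.mul_one]
  · rw [Matrix.det_mul, Matrix.det_nonsing_inv, Ring.inverse_eq_inv]
    exact isRUnit_mul hP₁det (isRUnit_inv hP₂det)
  · rw [Matrix.mul_inv_rev]
    simp only [Matrix.mul_assoc]
    rw [Matrix.nonsing_inv_mul _ hQ₂det, Matrix.mul_one]

/-- **Any two self-dual lattices of `(L_w³, H)` at an inert place are conjugate under `U(H)`** (lattice form):
there is `g` with `gᴴ H g = H` carrying the lattice `Q₂ · 𝒪³` onto `Q₁ · 𝒪³`. -/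
theorem exists_isometry_image_stdLattice_eq
    (h2 : finrank (v.adicCompletion K) (w.adicCompletion L) = 2)
    {ϖ : v.adicCompletionIntegers K} (hϖ : Irreducible ϖ)
    (hinert : Irreducible (algebraMap (v.adicCompletionIntegers K) (w.adicCompletionIntegers L) ϖ))
    (σ : w.adicCompletion L ≃ₐ[v.adicCompletion K] w.adicCompletion L) (hσ : σ ≠ 1)
    {H : Matrix (Fin 3) (Fin 3) (w.adicCompletion L)}
    (hH : letI := starRingOfQuadratic h2 σ hσ; H.IsHermitian) (hdet : IsUnit H.det)
    {Q₁ Q₂ : Matrix (Fin 3) (Fin 3) (w.adicCompletion L)} (hQ₁ : IsUnit Q₁) (hQ₂ : IsUnit Q₂)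
    (h₁ : letI := starRingOfQuadratic h2 σ hσ
      dualLattice (integralClosure (v.adicCompletionIntegers K) (w.adicCompletion L))
        (Q₁.conjTranspose * H * Q₁)
        (stdLattice (integralClosure (v.adicCompletionIntegers K) (w.adicCompletion L))) =
      stdLattice (integralClosure (v.adicCompletionIntegers K) (w.adicCompletion L)))
    (h₂ : letI := starRingOfQuadratic h2 σ hσ
      dualLattice (integralClosure (v.adicCompletionIntegers K) (w.adicCompletion L))
        (Q₂.conjTranspose * H * Q₂)
        (stdLattice (integralClosure (v.adicCompletionIntegers K) (w.adicCompletion L))) =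
      stdLattice (integralClosure (v.adicCompletionIntegers K) (w.adicCompletion L))) :
    letI := starRingOfQuadratic h2 σ hσ
    ∃ g : Matrix (Fin 3) (Fin 3) (w.adicCompletion L), g.conjTranspose * H * g = H ∧
      (fun x => g *ᵥ x) '' ((fun x => Q₂ *ᵥ x) ''
          stdLattice (integralClosure (v.adicCompletionIntegers K) (w.adicCompletion L))) =
        (fun x => Q₁ *ᵥ x) ''
          stdLattice (integralClosure (v.adicCompletionIntegers K) (w.adicCompletion L)) := by
  letI := starRingOfQuadratic h2 σ hσ
  obtain ⟨g, hg, M, hM, hMdet, hgQ⟩ :=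
    exists_isometry_mul_eq_of_dualLattice_eq v w h2 hϖ hinert σ hσ hH hdet hQ₁ hQ₂ h₁ h₂
  refine ⟨g, hg, ?_⟩
  -- `M ∈ GL₃(𝒪)` preserves the standard lattice (`M` and `M⁻¹` have integral entries)
  have hMdet' : IsUnit M.det := isUnit_iff_exists_inv.2 ⟨M.det⁻¹, mul_inv_cancel₀ hMdet.2.1⟩
  have hMstd : (fun x => M *ᵥ x) ''
      stdLattice (integralClosure (v.adicCompletionIntegers K) (w.adicCompletion L)) =
      stdLattice (integralClosure (v.adicCompletionIntegers K) (w.adicCompletion L)) := by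
    apply Set.Subset.antisymm
    · rintro _ ⟨x, hx, rfl⟩
      exact mulVec_mem_stdLattice hM hx
    · intro y hy
      refine ⟨M⁻¹ *ᵥ y, mulVec_mem_stdLattice (isInteger_inv_apply_of_isRUnit_det hM hMdet) hy, ?_⟩
      simp only [Matrix.mulVec_mulVec, Matrix.mul_nonsing_inv M hMdet', Matrix.one_mulVec]
  calc (fun x => g *ᵥ x) '' ((fun x => Q₂ *ᵥ x) ''
          stdLattice (integralClosure (v.adicCompletionIntegers K) (w.adicCompletion L)))
      = (fun x => (g * Q₂) *ᵥ x) ''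
          stdLattice (integralClosure (v.adicCompletionIntegers K) (w.adicCompletion L)) := by
        rw [Set.image_image]; simp only [Matrix.mulVec_mulVec]
    _ = (fun x => Q₁ *ᵥ (M *ᵥ x)) ''
          stdLattice (integralClosure (v.adicCompletionIntegers K) (w.adicCompletion L)) := by
        rw [hgQ]; simp only [Matrix.mulVec_mulVec]
    _ = (fun x => Q₁ *ᵥ x) '' ((fun x => M *ᵥ x) ''
          stdLattice (integralClosure (v.adicCompletionIntegers K) (w.adicCompletion L))) := by
        rw [Set.image_image]
    _ = (fun x => Q₁ *ᵥ x) ''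
          stdLattice (integralClosure (v.adicCompletionIntegers K) (w.adicCompletion L)) := by
        rw [hMstd]

end Local

end Summit.Ventures.HodgeRepro2.T5InertSelfDualUnique
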